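import Literature.Analysis.FluidPDE.Tao2016AveragedNS.SeedScaleSharpClosure
import HarnessLib

/-!
# The shadowing threshold of Tao's gate as one number: the critical budget

Note for the FLUID COMPUTER cell (pub-fluidc, blueprint seat bp1). HONEST FRAMING: this is a
low prior, high value-of-information experiment on Tao's machine paradigm
[Tao2016AveragedNS, §5.5]; NOT a claim that NS blows up. Everything here concerns Tao's five-mode
delay circuit `delayCircuitWith K M ε` (an ODE on `ℝ⁵`, RetunedCircuit.lean) under the standing
hypotheses of its Theorem 5.3 (`K ≥ 2·20⁴²·42! + 16`, `3000 log K ≤ M ≤ K¹⁰`,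
`0 < ε ≤ e^{-10M}K^{-100}`), and its pseudo-orbits (CircuitShadowing.lean).

The chain NegativeKickThreshold → SeedScaleSharpIgnition → SeedScaleSharpEntry →
SeedScaleSharpClosure located the dichotomy "fires / never fires" along pseudo-orbits issued near
Tao's datum (5.6) at the dud threshold `√(π/2)·ε²e^{-M}/√M = 1.25331…·ε²e^{-M}/√M`, as a PAIR of
theorems with the two rational levels `3133/2500 = 1.2532` (every pseudo-orbit within this total
budget fires, `IsPseudoOrbit.firedOn_from_two_sharp`) and `2507/2000 = 1.2535` (an exact trajectory
issued this close to (5.6) never fires, `exists_negativeKick_dud_pinned`). This file packages the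
pair as ONE NUMBER per member and tolerance, the CRITICAL BUDGET

  `criticalBudget K M ε e m := sSup {B | FiresUnderBudget K M ε e m B}`,

where `FiresUnderBudget K M ε e m B` (§1) says: every `δ`-pseudo-orbit `Y` of the member in the
sup-ball of radius `2` on `[0,T]` (`T ≥ 2`) issued `δ₀`-close to (5.6) with TOTAL BUDGET
`δ₀ + δT ≤ B` is in the fired state `FiredOn K Y [2,T] e m` of SeedScaleSharpClosure.lean
(`|ã - 1| ≤ e/K²⁰` and `|a|, |b|, |c|, |d| ≤ m/K¹⁰` on `[2,T]`). Results, all under the standing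
hypotheses and for EVERY tolerance `6 ≤ e ≤ K²⁰/2`, `4 ≤ m`:

* THRESHOLD (§3): budgets `B < criticalBudget` fire, budgets `B > criticalBudget` do not
  (`criticalBudget_threshold`);
* BRACKET (§3): `1.2532·ε²e^{-M}/√M ≤ criticalBudget ≤ 1.2535·ε²e^{-M}/√M`
  (`criticalBudget_mem_Icc`); equivalently the number is `√(π/2)·ε²e^{-M}/√M` to a relative
  `1.5·10⁻⁴` (`criticalBudget_pinned`);
* ABRUPTNESS AS TOLERANCE-INSENSITIVITY (§3): the bracket does not depend on `(e, m)` — the budget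
  forcing the COMPLETE transfer `|ã - 1| ≤ 6K⁻²⁰, |a|,…,|d| ≤ 4K⁻¹⁰` on all of `[2,T]` and the
  budget merely forcing `ã(2) ≥ 1/2` differ by at most `3·10⁻⁴·ε²e^{-M}/√M`
  (`criticalBudget_tol_insensitive`): there is no partially-fired regime of budgets;
* IGNITION = FIRING (§4): the ignition threshold
  `criticalIgnition K M ε τ := sSup {B | IgnitesWithin K M ε B τ}` (the trigger leaves the band
  `|c| ≤ ε²` by time `τ ∈ [8/5, 2]`, SeedScaleSharpIgnition.lean) obeys the same bracket, hence
  `|criticalBudget - criticalIgnition| ≤ 3·10⁻⁴·ε²e^{-M}/√M` (`criticalBudget_sub_criticalIgnition`):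
  a perturbation either fails to ignite the trigger, or fires the gate completely;
* TUNINGS (§5): on Tao's tuning `M = K¹⁰` the critical budget lies in
  `[1.2532, 1.2535]·ε²e^{-K¹⁰}/K⁵` (`criticalBudget_tao`); on the log-retuned members
  `M = p log K` (`p ≥ 3000`, `e^{-M} = K^{-p}`) it is POLYNOMIAL in `K`:
  `[1.2532, 1.2535]·ε²/(K^p·√(p log K))` (`criticalBudget_log`), and the budget `ε²/K^{p+5}` fires
  every such member (`firesUnderBudget_log`) — the honest positive form of the cell's question
  (D)(4) (`PseudoOrbitTransition q`: budget `ε²/K^q` uniformly on the family, refuted for every `q`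
  by seed cancellation, SeedCancellation.lean): a polynomial shadowing budget suffices exactly when
  the seed `ε²e^{-M}` is itself polynomial.

In this language the cell's decided seed-scale question reads
`PseudoOrbitTransitionSeed q ↔ ∀ member, FiresUnderBudget K M ε (K²⁰/4) (K¹⁰/4) (ε²e^{-M}/K^q)`
(`pseudoOrbitTransitionSeed_iff_firesUnderBudget`; true iff `q ≥ 5`, SeedScaleSharpClosure.lean).

For the cell's spec sheet (report-only): `critical_budget ∈ [1.2532, 1.2535]·ε²e^{-M}/√M`
(numerically `√(π/2) = 1.25331…`) in the sup-norm of `ℝ⁵`, datum error `δ₀` and forcing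
`δ = sup_{[0,T)} ‖Ẏ - F(Y)‖` counted in the one budget `δ₀ + δT`. Schematic choices (what is NOT
from the paper): the budget functional `δ₀ + δT`, the confinement radius `2`, the fired tolerances
`(e/K²⁰, m/K¹⁰)` and the window `[2,T]` are the cell's (DIVERGENCE.md); [Tao2016AveragedNS,
Theorem 5.3] is the exact-trajectory statement `δ = δ₀ = 0`.
-/

noncomputable section

open Real Set MeasureTheory

namespace Literature.Analysis.FluidPDE.Tao2016AveragedNS

open scoped NNReal

/-! ## §1. Firing under a total budget; the two critical numbers -/

/-- `FiredOn` is monotone in the tolerances (`K²⁰ ≥ 0`, `K¹⁰ ≥ 0`). [folklore] -/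
theorem FiredOn.mono_tol {K : ℝ} {Y : ℝ → Fin 5 → ℝ} {S : Set ℝ} {e m e' m' : ℝ}
    (h : FiredOn K Y S e m) (he : e ≤ e') (hm : m ≤ m') : FiredOn K Y S e' m' := by
  intro t ht
  obtain ⟨h4, hi⟩ := h t ht
  exact ⟨h4.trans (div_le_div_of_nonneg_right he (by positivity)),
    fun i hi' => (hi i hi').trans (div_le_div_of_nonneg_right hm (by positivity))⟩

/-- **Fires under the total budget `B` (tolerances `e`, `m`).** Every `δ`-pseudo-orbit `Y` of the
member `delayCircuitWith K M ε` in the sup-ball of radius `2` on `[0,T]` (`T ≥ 2`; continuous on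
`[0,T]`, right-differentiable with defect `≤ δ` on `[0,T)`), issued `δ₀`-close to Tao's datum (5.6)
(`delayInit`), with total budget `δ₀ + δT ≤ B`, is FIRED on `[2,T]` with tolerances `(e, m)`:
`|ã - 1| ≤ e/K²⁰` and `|a|, |b|, |c|, |d| ≤ m/K¹⁰` there (`FiredOn`). Antitone in `B`, monotone in
`(e, m)`; its supremum over `B` is the critical budget. The conclusion of
[Tao2016AveragedNS, Theorem 5.3] along pseudo-orbits, quantified by the budget.
[cite: Tao2016AveragedNS, §5.5 Theorem 5.3] -/
def FiresUnderBudget (K M ε e m B : ℝ) : Prop :=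
  ∀ (δ δ₀ T : ℝ) (Y : ℝ → Fin 5 → ℝ), 2 ≤ T → IsPseudoOrbit (delayCircuitWith K M ε) δ 2 T Y →
    ‖Y 0 - delayInit‖ ≤ δ₀ → δ₀ + δ * T ≤ B → FiredOn K Y (Icc 2 T) e m

/-- `FiresUnderBudget` is antitone in the budget. [folklore] -/
theorem FiresUnderBudget.anti {K M ε e m B B' : ℝ} (h : FiresUnderBudget K M ε e m B)
    (hB : B' ≤ B) : FiresUnderBudget K M ε e m B' :=
  fun δ δ₀ T Y hT hY h0 hb => h δ δ₀ T Y hT hY h0 (hb.trans hB)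

/-- `FiresUnderBudget` is monotone in the tolerances. [folklore] -/
theorem FiresUnderBudget.mono_tol {K M ε e m e' m' B : ℝ} (h : FiresUnderBudget K M ε e m B)
    (he : e ≤ e') (hm : m ≤ m') : FiresUnderBudget K M ε e' m' B :=
  fun δ δ₀ T Y hT hY h0 hb => (h δ δ₀ T Y hT hY h0 hb).mono_tol he hm

/-- **The critical budget** of the member `delayCircuitWith K M ε` at tolerances `(e, m)`: the
supremum of the total budgets `B` under which every pseudo-orbit issued near (5.6) fires on `[2,T]`
(`FiresUnderBudget`). Under the standing hypotheses and for `6 ≤ e ≤ K²⁰/2`, `4 ≤ m` it is a genuine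
threshold (`criticalBudget_threshold`) and equals `√(π/2)·ε²e^{-M}/√M` to a relative `1.5·10⁻⁴`
(`criticalBudget_pinned`). A cell quantity (the paper has no perturbations), reported as
`critical_budget`. [cite: Tao2016AveragedNS, §5.5 Theorem 5.3] -/
def criticalBudget (K M ε e m : ℝ) : ℝ :=
  sSup {B : ℝ | FiresUnderBudget K M ε e m B}

/-- **The critical ignition budget** of the member by time `τ`: the supremum of the total budgets `B`
such that every differentiable approximate trajectory within budget `B` carries its trigger out of
the band `|c| ≤ ε²` by time `τ` (`IgnitesWithin`, SeedScaleSharpIgnition.lean). For `τ ∈ [8/5, 2]`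
it obeys the same bracket as the critical budget (`criticalIgnition_mem_Icc`).
[cite: Tao2016AveragedNS, §5.5 Theorem 5.3] -/
def criticalIgnition (K M ε τ : ℝ) : ℝ :=
  sSup {B : ℝ | IgnitesWithin K M ε B τ}

/-! ## §2. The two sides of the threshold -/

section Standing

variable {K M ε : ℝ} (hK : 2 * 20 ^ 42 * (Nat.factorial 42 : ℝ) + 16 ≤ K)
  (hML : 3000 * Real.log K ≤ M) (hMK : M ≤ K ^ 10) (hε : 0 < ε)
  (hεle : ε ≤ exp (-(10 * M)) / K ^ 100)
include hK hML hMK hε hεle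

/-- **Every budget below `1.2532·ε²e^{-M}/√M` fires**, at every tolerance `e ≥ 6`, `m ≥ 4`
(Theorem 5.3 along pseudo-orbits at the sharp budget, `IsPseudoOrbit.firedOn_from_two_sharp`:
`|ã - 1| ≤ 6K⁻²⁰`, `|a|,…,|d| ≤ 4K⁻¹⁰` on `[2,T]`). [cite: Tao2016AveragedNS, §5.5 Theorem 5.3] -/
theorem firesUnderBudget_of_lt {e m B : ℝ}
    (hB : B < 3133 / 2500 * (ε ^ 2 * exp (-M)) / Real.sqrt M) (he : 6 ≤ e) (hm : 4 ≤ m) :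
    FiresUnderBudget K M ε e m B :=
  fun _ _ _ _ hT hY h0 hb =>
    (hY.firedOn_from_two_sharp hK hML hMK hε hεle hT h0 (hb.trans_lt hB)).mono_tol he hm

/-- **The `q = 5` budget `ε²e^{-M}/K⁵` fires** every member (`M ≤ K¹⁰`, so `K⁵ ≥ √M`;
`IsPseudoOrbit.firedOn_from_two_pow_five`). [cite: Tao2016AveragedNS, §5.5 Theorem 5.3] -/
theorem firesUnderBudget_pow_five {e m : ℝ} (he : 6 ≤ e) (hm : 4 ≤ m) :
    FiresUnderBudget K M ε e m (ε ^ 2 * exp (-M) / K ^ 5) :=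
  fun _ _ _ _ hT hY h0 hb =>
    (hY.firedOn_from_two_pow_five hK hML hMK hε hεle hT h0 hb).mono_tol he hm

/-- **No budget `≥ 1.2535·ε²e^{-M}/√M` fires**, at any tolerance with `e/K²⁰ ≤ 1/2` (i.e. whenever
"fired" at least distinguishes `ã ≈ 1` from `ã ≈ 0`): the pinned negative-kick dud
(`exists_negativeKick_dud_pinned`) is an EXACT trajectory (`δ = 0`) issued within `κ < 1.2535·ε²e^{-M}/√M`
of (5.6) whose output mode stays `|ã| ≤ 6e^{-M} ≤ 0.12` up to time `2`.
[cite: Tao2016AveragedNS, §5.5 Theorem 5.3] -/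
theorem not_firesUnderBudget_of_ge {e m B : ℝ}
    (hB : 2507 / 2000 * (ε ^ 2 * exp (-M)) / Real.sqrt M ≤ B) (he : e ≤ K ^ 20 / 2) :
    ¬ FiresUnderBudget K M ε e m B := by
  intro h
  obtain ⟨κ, hκ1, hκ2, -, hdud⟩ := exists_negativeKick_dud_pinned hK hML hMK hε hεle
  obtain ⟨hK16, hM4, -, hs3, -, hexpM⟩ := negKick_params hK hML hMK hε hεle
  have hKpos : (0 : ℝ) < K := by linarith
  have hM0 : 0 < M := by linarith
  have hsq1 : 1 ≤ Real.sqrt M := Real.one_le_sqrt.2 (by linarith)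
  have hs0 : 0 < ε ^ 2 * exp (-M) := by positivity
  have hL0 : 0 < 3133 / 2500 * (ε ^ 2 * exp (-M)) / Real.sqrt M := by positivity
  have hκ0 : 0 < κ := hL0.trans hκ1
  have hκ1' : κ ≤ 1 := by
    have h1 : 2507 / 2000 * (ε ^ 2 * exp (-M)) / Real.sqrt M ≤ 2507 / 2000 * (ε ^ 2 * exp (-M)) :=
      div_le_self (by positivity) hsq1
    linarith
  have hκsq : (-κ) ^ 2 ≤ 1 := by rw [neg_sq]; nlinarith
  -- the dud as a `0`-pseudo-orbit in the ball of radius `2` on `[0,2]`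
  set Y : ℝ → Fin 5 → ℝ := fun t => delayFlowWith K M ε t (kickInit (-κ)) with hYdef
  have hY : IsPseudoOrbit (delayCircuitWith K M ε) 0 2 2 Y :=
    kickW_isPseudoOrbit (hasDerivAt_delayFlowWith K M ε _) (delayFlowWith_zero K M ε _) hκsq 2
      (by norm_num)
  have h0 : ‖Y 0 - delayInit‖ ≤ κ := by
    simp only [hYdef, delayFlowWith_zero]
    exact norm_kickInit_neg_sub_delayInit hκ0.le hκ1'
  have hbud : κ + 0 * 2 ≤ B := by linarith
  have hfire := (h 0 κ 2 Y le_rfl hY h0 hbud 2 ⟨le_rfl, le_rfl⟩).1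
  have hq4 := (hdud 2 (right_mem_Icc.2 (by norm_num))).2.2.2
  have hK20 : (0 : ℝ) < K ^ 20 := by positivity
  have heK : e / K ^ 20 ≤ 1 / 2 := by rw [div_le_iff₀ hK20]; linarith
  have h1 : 1 / 2 ≤ Y 2 4 := by
    have := (abs_sub_le_iff.1 hfire).2
    linarith
  have h6 : 6 * exp (-M) ≤ 6 / 50 := by linarith
  have h2 : delayFlowWith K M ε 2 (kickInit (-κ)) 4 ≤ 6 / 50 := ((abs_le.1 hq4).2).trans h6
  change 1 / 2 ≤ delayFlowWith K M ε 2 (kickInit (-κ)) 4 at h1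
  linarith

/-- A budget that fires (tolerance `e ≤ K²⁰/2`) is below the dud level `1.2535·ε²e^{-M}/√M`.
[cite: Tao2016AveragedNS, §5.5 Theorem 5.3] -/
theorem FiresUnderBudget.lt_dud {e m B : ℝ} (he : e ≤ K ^ 20 / 2)
    (h : FiresUnderBudget K M ε e m B) : B < 2507 / 2000 * (ε ^ 2 * exp (-M)) / Real.sqrt M :=
  not_le.1 fun hB => not_firesUnderBudget_of_ge hK hML hMK hε hεle hB he h

/-! ## §3. The critical budget: threshold, bracket, `√(π/2)`, tolerance-insensitivity -/

/-- **The bracket.** For every tolerance `6 ≤ e ≤ K²⁰/2`, `4 ≤ m`: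
`1.2532·ε²e^{-M}/√M ≤ criticalBudget K M ε e m ≤ 1.2535·ε²e^{-M}/√M`. The bracket is uniform in
the tolerances: asking for the complete transfer of Theorem 5.3 or merely for `ã(2) ≥ 1/2` changes
the threshold by less than `2.4·10⁻⁴` of its value. [cite: Tao2016AveragedNS, §5.5 Theorem 5.3] -/
theorem criticalBudget_mem_Icc {e m : ℝ} (he : 6 ≤ e) (he' : e ≤ K ^ 20 / 2) (hm : 4 ≤ m) :
    criticalBudget K M ε e m ∈
      Icc (3133 / 2500 * (ε ^ 2 * exp (-M)) / Real.sqrt M)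
        (2507 / 2000 * (ε ^ 2 * exp (-M)) / Real.sqrt M) := by
  unfold criticalBudget
  have hup : ∀ B ∈ {B : ℝ | FiresUnderBudget K M ε e m B},
      B ≤ 2507 / 2000 * (ε ^ 2 * exp (-M)) / Real.sqrt M :=
    fun B hB => (FiresUnderBudget.lt_dud hK hML hMK hε hεle he' hB).le
  have hbdd : BddAbove {B : ℝ | FiresUnderBudget K M ε e m B} := ⟨_, hup⟩
  have hne : {B : ℝ | FiresUnderBudget K M ε e m B}.Nonempty :=
    ⟨_, firesUnderBudget_pow_five hK hML hMK hε hεle he hm⟩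
  refine ⟨?_, csSup_le hne hup⟩
  rw [← not_lt]
  intro hlt
  have hBL : (sSup {B : ℝ | FiresUnderBudget K M ε e m B} +
      3133 / 2500 * (ε ^ 2 * exp (-M)) / Real.sqrt M) / 2 <
      3133 / 2500 * (ε ^ 2 * exp (-M)) / Real.sqrt M := by linarith
  have hmem := le_csSup hbdd (firesUnderBudget_of_lt hK hML hMK hε hεle hBL he hm)
  linarith

/-- **The critical budget is a threshold.** For `6 ≤ e ≤ K²⁰/2`, `4 ≤ m`: every budget
`B < criticalBudget` fires (all pseudo-orbits within it are fired on `[2,T]`), and no budget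
`B > criticalBudget` does (some pseudo-orbit within it — in fact an exact trajectory — is not).
Whether the supremum itself fires is left open (the set of firing budgets is an interval
`(-∞, B*)` or `(-∞, B*]`). [cite: Tao2016AveragedNS, §5.5 Theorem 5.3] -/
theorem criticalBudget_threshold {e m : ℝ} (he : 6 ≤ e) (he' : e ≤ K ^ 20 / 2) (hm : 4 ≤ m) :
    (∀ B, B < criticalBudget K M ε e m → FiresUnderBudget K M ε e m B) ∧
      ∀ B, criticalBudget K M ε e m < B → ¬ FiresUnderBudget K M ε e m B := by
  refine ⟨fun B hB => ?_, fun B hB h => ?_⟩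
  · obtain ⟨B', hB', hBB'⟩ := exists_lt_of_lt_csSup
      ⟨_, firesUnderBudget_pow_five hK hML hMK hε hεle he hm⟩ hB
    exact FiresUnderBudget.anti hB' hBB'.le
  · have hup : ∀ B' ∈ {B : ℝ | FiresUnderBudget K M ε e m B},
        B' ≤ 2507 / 2000 * (ε ^ 2 * exp (-M)) / Real.sqrt M :=
      fun B' hB' => (FiresUnderBudget.lt_dud hK hML hMK hε hεle he' hB').le
    have := le_csSup ⟨_, hup⟩ h
    unfold criticalBudget at hB
    linarith

/-- **The critical budget is `√(π/2)·ε²e^{-M}/√M` to a relative `1.5·10⁻⁴`**, at every tolerance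
`6 ≤ e ≤ K²⁰/2`, `4 ≤ m` (`1.2532 ≥ (1 - 1.5·10⁻⁴)·√(π/2)` and `1.2535 ≤ (1 + 1.5·10⁻⁴)·√(π/2)` from
`3.141592 < π < 3.141593`; `√(π/2)·ε²e^{-M}/√M` is the Gaussian clock-window mass of the negative-kick
dud, NegativeKickThreshold.lean). [cite: Tao2016AveragedNS, §5.5 Theorem 5.3] -/
theorem criticalBudget_pinned {e m : ℝ} (he : 6 ≤ e) (he' : e ≤ K ^ 20 / 2) (hm : 4 ≤ m) :
    |criticalBudget K M ε e m - Real.sqrt (π / 2) * (ε ^ 2 * exp (-M)) / Real.sqrt M| ≤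
      3 / 20000 * (Real.sqrt (π / 2) * (ε ^ 2 * exp (-M)) / Real.sqrt M) := by
  obtain ⟨h1, h2⟩ := criticalBudget_mem_Icc hK hML hMK hε hεle he he' hm
  obtain ⟨-, hM4, -⟩ := negKick_params hK hML hMK hε hεle
  have hM0 : 0 < M := by linarith
  set t : ℝ := ε ^ 2 * exp (-M) / Real.sqrt M with ht
  have ht0 : 0 < t := by positivity
  have eL : 3133 / 2500 * (ε ^ 2 * exp (-M)) / Real.sqrt M = 3133 / 2500 * t := by rw [ht]; ring
  have eU : 2507 / 2000 * (ε ^ 2 * exp (-M)) / Real.sqrt M = 2507 / 2000 * t := by rw [ht]; ring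
  have eP : Real.sqrt (π / 2) * (ε ^ 2 * exp (-M)) / Real.sqrt M = Real.sqrt (π / 2) * t := by
    rw [ht]; ring
  rw [eL] at h1
  rw [eU] at h2
  rw [eP]
  have hπ := Real.pi_gt_d6
  have hπ' := Real.pi_lt_d6
  -- `1.2535 ≤ (1 + 1.5e-4)·√(π/2)` and `(1 - 1.5e-4)·√(π/2) ≤ 1.2532`
  have hlo : (2507 / 2000 : ℝ) ≤ 20003 / 20000 * Real.sqrt (π / 2) := by
    have hn : ((2507 : ℝ) / 2000 * (20000 / 20003)) ^ 2 ≤ 3.141592 / 2 := by norm_num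
    have h1 : (2507 : ℝ) / 2000 * (20000 / 20003) ≤ Real.sqrt (π / 2) := by
      rw [Real.le_sqrt (by norm_num) (by positivity)]
      linarith
    linarith
  have hhi : (19997 / 20000 : ℝ) * Real.sqrt (π / 2) ≤ 3133 / 2500 := by
    have hn : (3.141593 : ℝ) / 2 ≤ (3133 / 2500 * (20000 / 19997)) ^ 2 := by norm_num
    have h1 : Real.sqrt (π / 2) ≤ 3133 / 2500 * (20000 / 19997) := by
      rw [Real.sqrt_le_left (by norm_num)]
      linarith
    linarith
  have hlo' := mul_le_mul_of_nonneg_right hlo ht0.le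
  have hhi' := mul_le_mul_of_nonneg_right hhi ht0.le
  rw [abs_sub_le_iff]
  constructor <;> nlinarith

/-- **Tolerance-insensitivity (abruptness).** Any two admissible tolerance pairs have critical
budgets within `3·10⁻⁴·ε²e^{-M}/√M` of each other (`< 2.4·10⁻⁴` relative): the budget forcing the
complete transfer (`e = 6`, `m = 4`) and the budget merely forcing `ã(2) ≥ 1/2` (`e = K²⁰/2`, any `m`)
agree to that precision. [cite: Tao2016AveragedNS, §5.5 Theorem 5.3] -/
theorem criticalBudget_tol_insensitive {e m e' m' : ℝ} (he : 6 ≤ e) (hE : e ≤ K ^ 20 / 2)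
    (hm : 4 ≤ m) (he' : 6 ≤ e') (hE' : e' ≤ K ^ 20 / 2) (hm' : 4 ≤ m') :
    |criticalBudget K M ε e m - criticalBudget K M ε e' m'| ≤
      3 / 10000 * (ε ^ 2 * exp (-M)) / Real.sqrt M := by
  obtain ⟨h1, h2⟩ := criticalBudget_mem_Icc hK hML hMK hε hεle he hE hm
  obtain ⟨h3, h4⟩ := criticalBudget_mem_Icc hK hML hMK hε hεle he' hE' hm'
  have hUL : 2507 / 2000 * (ε ^ 2 * exp (-M)) / Real.sqrt M -
      3133 / 2500 * (ε ^ 2 * exp (-M)) / Real.sqrt M =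
      3 / 10000 * (ε ^ 2 * exp (-M)) / Real.sqrt M := by ring
  rw [abs_sub_le_iff]
  constructor <;> linarith

/-- The critical budget is monotone in the tolerances (on the admissible range).
[cite: Tao2016AveragedNS, §5.5 Theorem 5.3] -/
theorem criticalBudget_mono_tol {e m e' m' : ℝ} (he : 6 ≤ e) (hm : 4 ≤ m) (hee' : e ≤ e')
    (hmm' : m ≤ m') (hE' : e' ≤ K ^ 20 / 2) :
    criticalBudget K M ε e m ≤ criticalBudget K M ε e' m' := by
  unfold criticalBudget
  refine csSup_le_csSup ⟨2507 / 2000 * (ε ^ 2 * exp (-M)) / Real.sqrt M, fun B hB => ?_⟩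
    ⟨_, firesUnderBudget_pow_five hK hML hMK hε hεle he hm⟩ fun B hB => ?_
  · exact (FiresUnderBudget.lt_dud hK hML hMK hε hεle hE' hB).le
  · exact FiresUnderBudget.mono_tol hB hee' hmm'

/-! ## §4. Ignition = firing: the critical ignition budget -/

/-- **The critical ignition budget obeys the same bracket**: for `τ ∈ [8/5, 2]`,
`1.2532·ε²e^{-M}/√M ≤ criticalIgnition K M ε τ ≤ 1.2535·ε²e^{-M}/√M` (`ignitesWithin_sharp`: the
lower level ignites by time `8/5`; `not_ignitesWithin_of_ge`: the pinned dud keeps `|c| ≤ ε²` up to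
time `2`). [cite: Tao2016AveragedNS, §5.5 Theorem 5.3] -/
theorem criticalIgnition_mem_Icc {τ : ℝ} (hτ : τ ∈ Icc (8 / 5 : ℝ) 2) :
    criticalIgnition K M ε τ ∈
      Icc (3133 / 2500 * (ε ^ 2 * exp (-M)) / Real.sqrt M)
        (2507 / 2000 * (ε ^ 2 * exp (-M)) / Real.sqrt M) := by
  unfold criticalIgnition
  have hup : ∀ B ∈ {B : ℝ | IgnitesWithin K M ε B τ},
      B ≤ 2507 / 2000 * (ε ^ 2 * exp (-M)) / Real.sqrt M :=
    fun B hB => le_of_lt (not_le.1 fun hge => not_ignitesWithin_of_ge hK hML hMK hε hεle hge hτ.2 hB)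
  have hbdd : BddAbove {B : ℝ | IgnitesWithin K M ε B τ} := ⟨_, hup⟩
  have hlow : IgnitesWithin K M ε (3133 / 2500 * (ε ^ 2 * exp (-M)) / Real.sqrt M) τ :=
    (ignitesWithin_sharp hK hML hMK hε hεle).mono hτ.1
  exact ⟨le_csSup hbdd hlow, csSup_le ⟨_, hlow⟩ hup⟩

/-- **The critical ignition budget is a threshold** (`τ ∈ [8/5, 2]`): every budget below it ignites
the trigger by time `τ` along every approximate trajectory, no budget above it does.
[cite: Tao2016AveragedNS, §5.5 Theorem 5.3] -/
theorem criticalIgnition_threshold {τ : ℝ} (hτ : τ ∈ Icc (8 / 5 : ℝ) 2) :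
    (∀ B, B < criticalIgnition K M ε τ → IgnitesWithin K M ε B τ) ∧
      ∀ B, criticalIgnition K M ε τ < B → ¬ IgnitesWithin K M ε B τ := by
  have hlow : IgnitesWithin K M ε (3133 / 2500 * (ε ^ 2 * exp (-M)) / Real.sqrt M) τ :=
    (ignitesWithin_sharp hK hML hMK hε hεle).mono hτ.1
  refine ⟨fun B hB => ?_, fun B hB h => ?_⟩
  · obtain ⟨B', hB', hBB'⟩ := exists_lt_of_lt_csSup ⟨_, hlow⟩ hB
    exact IgnitesWithin.anti hB' hBB'.le
  · have hup : ∀ B' ∈ {B : ℝ | IgnitesWithin K M ε B τ},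
        B' ≤ 2507 / 2000 * (ε ^ 2 * exp (-M)) / Real.sqrt M :=
      fun B' hB' =>
        le_of_lt (not_le.1 fun hge => not_ignitesWithin_of_ge hK hML hMK hε hεle hge hτ.2 hB')
    have := le_csSup ⟨_, hup⟩ h
    unfold criticalIgnition at hB
    linarith

/-- **Ignition = firing.** The total budget needed to push the trigger out of the band `|c| ≤ ε²`
by any time `τ ∈ [8/5, 2]` and the total budget needed to FIRE the gate completely on `[2,T]`
(any admissible tolerance) agree to within `3·10⁻⁴·ε²e^{-M}/√M`: there is no intermediate regime in
which a perturbation ignites the trigger without the full abrupt transfer following.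
[cite: Tao2016AveragedNS, §5.5 Theorem 5.3] -/
theorem criticalBudget_sub_criticalIgnition {e m τ : ℝ} (he : 6 ≤ e) (he' : e ≤ K ^ 20 / 2)
    (hm : 4 ≤ m) (hτ : τ ∈ Icc (8 / 5 : ℝ) 2) :
    |criticalBudget K M ε e m - criticalIgnition K M ε τ| ≤
      3 / 10000 * (ε ^ 2 * exp (-M)) / Real.sqrt M := by
  obtain ⟨h1, h2⟩ := criticalBudget_mem_Icc hK hML hMK hε hεle he he' hm
  obtain ⟨h3, h4⟩ := criticalIgnition_mem_Icc hK hML hMK hε hεle hτ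
  have hUL : 2507 / 2000 * (ε ^ 2 * exp (-M)) / Real.sqrt M -
      3133 / 2500 * (ε ^ 2 * exp (-M)) / Real.sqrt M =
      3 / 10000 * (ε ^ 2 * exp (-M)) / Real.sqrt M := by ring
  rw [abs_sub_le_iff]
  constructor <;> linarith

end Standing

/-! ## §5. Tunings: Tao's `M = K¹⁰`, and the log-retuned members `M = p log K` -/

/-- The standing lower bound `3000 log K ≤ K¹⁰` is automatic for `K ≥ 2·20⁴²·42! + 16`. [folklore] -/
theorem log_le_pow_ten_of_K {K : ℝ} (hK : 2 * 20 ^ 42 * (Nat.factorial 42 : ℝ) + 16 ≤ K) :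
    3000 * Real.log K ≤ K ^ 10 := by
  have hB : (0 : ℝ) ≤ 2 * 20 ^ 42 * (Nat.factorial 42 : ℝ) := by positivity
  have hK1 : (1 : ℝ) ≤ K := by linarith
  have hKpos : (0 : ℝ) < K := by linarith
  have hlogK : Real.log K ≤ K := (Real.log_le_sub_one_of_pos hKpos).trans (by linarith)
  have hbig : (3000 : ℝ) ≤ 2 * 20 ^ 42 * (Nat.factorial 42 : ℝ) :=
    calc (3000 : ℝ) ≤ 2 * 20 ^ 42 := by norm_num
      _ = 2 * 20 ^ 42 * 1 := (mul_one _).symm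
      _ ≤ 2 * 20 ^ 42 * (Nat.factorial 42 : ℝ) := by
        gcongr; exact_mod_cast Nat.succ_le_of_lt (Nat.factorial_pos 42)
  calc 3000 * Real.log K ≤ 3000 * K := by gcongr
    _ ≤ K * K := by gcongr; linarith
    _ = K ^ 2 := by ring
    _ ≤ K ^ 10 := pow_le_pow_right₀ hK1 (by norm_num)

/-- **The critical budget of Tao's own gate (`M = K¹⁰`, `√M = K⁵`)**:
`criticalBudget ∈ [1.2532, 1.2535]·ε²e^{-K¹⁰}/K⁵` at every tolerance `6 ≤ e ≤ K²⁰/2`, `4 ≤ m`, for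
`K ≥ 2·20⁴²·42! + 16` and `0 < ε ≤ e^{-10K¹⁰}K^{-100}`. [cite: Tao2016AveragedNS, §5.5 Theorem 5.3] -/
theorem criticalBudget_tao {K ε e m : ℝ} (hK : 2 * 20 ^ 42 * (Nat.factorial 42 : ℝ) + 16 ≤ K)
    (hε : 0 < ε) (hεle : ε ≤ exp (-(10 * K ^ 10)) / K ^ 100) (he : 6 ≤ e) (he' : e ≤ K ^ 20 / 2)
    (hm : 4 ≤ m) :
    criticalBudget K (K ^ 10) ε e m ∈
      Icc (3133 / 2500 * (ε ^ 2 * exp (-K ^ 10)) / K ^ 5)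
        (2507 / 2000 * (ε ^ 2 * exp (-K ^ 10)) / K ^ 5) := by
  have hB : (0 : ℝ) ≤ 2 * 20 ^ 42 * (Nat.factorial 42 : ℝ) := by positivity
  have hK0 : (0 : ℝ) ≤ K := by linarith
  have hsq : Real.sqrt (K ^ 10) = K ^ 5 := by
    rw [show (K ^ 10 : ℝ) = (K ^ 5) ^ 2 by ring, Real.sqrt_sq (by positivity)]
  have h := criticalBudget_mem_Icc hK (log_le_pow_ten_of_K hK) le_rfl hε hεle he he' hm
  rw [hsq] at h
  exact h

/-- **The critical budget of a log-retuned member (`M = p log K`, `e^{-M} = K^{-p}`) is polynomial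
in `K`**: `criticalBudget ∈ [1.2532, 1.2535]·ε²/(K^p·√(p log K))` at every tolerance
`6 ≤ e ≤ K²⁰/2`, `4 ≤ m`, for `p ≥ 3000`, `p log K ≤ K¹⁰`, `0 < ε ≤ e^{-10 p log K}K^{-100}`.
[cite: Tao2016AveragedNS, §5.5 Theorem 5.3] -/
theorem criticalBudget_log {K ε e m : ℝ} {p : ℕ}
    (hK : 2 * 20 ^ 42 * (Nat.factorial 42 : ℝ) + 16 ≤ K) (hp : (3000 : ℝ) ≤ p)
    (hpK : (p : ℝ) * Real.log K ≤ K ^ 10) (hε : 0 < ε)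
    (hεle : ε ≤ exp (-(10 * ((p : ℝ) * Real.log K))) / K ^ 100) (he : 6 ≤ e)
    (he' : e ≤ K ^ 20 / 2) (hm : 4 ≤ m) :
    criticalBudget K (p * Real.log K) ε e m ∈
      Icc (3133 / 2500 * ε ^ 2 / (K ^ p * Real.sqrt (p * Real.log K)))
        (2507 / 2000 * ε ^ 2 / (K ^ p * Real.sqrt (p * Real.log K))) := by
  have hB : (0 : ℝ) ≤ 2 * 20 ^ 42 * (Nat.factorial 42 : ℝ) := by positivity
  have hK1 : (1 : ℝ) ≤ K := by linarith
  have hK0 : (0 : ℝ) < K := by linarith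
  have hML : 3000 * Real.log K ≤ (p : ℝ) * Real.log K :=
    mul_le_mul_of_nonneg_right hp (Real.log_nonneg hK1)
  have h := criticalBudget_mem_Icc hK hML hpK hε hεle he he' hm
  have hexp : exp (-((p : ℝ) * Real.log K)) = (K ^ p)⁻¹ := exp_neg_natMul_log hK0 p
  have e1 : 3133 / 2500 * ε ^ 2 / (K ^ p * Real.sqrt (p * Real.log K)) =
      3133 / 2500 * (ε ^ 2 * exp (-((p : ℝ) * Real.log K))) / Real.sqrt (p * Real.log K) := by
    rw [hexp]; ring
  have e2 : 2507 / 2000 * ε ^ 2 / (K ^ p * Real.sqrt (p * Real.log K)) =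
      2507 / 2000 * (ε ^ 2 * exp (-((p : ℝ) * Real.log K))) / Real.sqrt (p * Real.log K) := by
    rw [hexp]; ring
  rw [e1, e2]
  exact h

/-- **A polynomial budget fires the log-retuned members**: for `M = p log K` (`p ≥ 3000`,
`p log K ≤ K¹⁰`, `0 < ε ≤ K^{-10p-100}` in the form `e^{-10M}K^{-100}`), every pseudo-orbit issued near
(5.6) with `δ₀ + δT ≤ ε²/K^{p+5}` is fired on `[2,T]` (`|ã - 1| ≤ 6K⁻²⁰`, `|a|,…,|d| ≤ 4K⁻¹⁰`, or any
laxer tolerance). The honest positive form of the cell's question (D)(4).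
[cite: Tao2016AveragedNS, §5.5 Theorem 5.3] -/
theorem firesUnderBudget_log {K ε e m : ℝ} {p : ℕ}
    (hK : 2 * 20 ^ 42 * (Nat.factorial 42 : ℝ) + 16 ≤ K) (hp : (3000 : ℝ) ≤ p)
    (hpK : (p : ℝ) * Real.log K ≤ K ^ 10) (hε : 0 < ε)
    (hεle : ε ≤ exp (-(10 * ((p : ℝ) * Real.log K))) / K ^ 100) (he : 6 ≤ e) (hm : 4 ≤ m) :
    FiresUnderBudget K (p * Real.log K) ε e m (ε ^ 2 / K ^ (p + 5)) := by
  have hB : (0 : ℝ) ≤ 2 * 20 ^ 42 * (Nat.factorial 42 : ℝ) := by positivity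
  have hK1 : (1 : ℝ) ≤ K := by linarith
  have hK0 : (0 : ℝ) < K := by linarith
  have hML : 3000 * Real.log K ≤ (p : ℝ) * Real.log K :=
    mul_le_mul_of_nonneg_right hp (Real.log_nonneg hK1)
  have h := firesUnderBudget_pow_five hK hML hpK hε hεle he hm
  have e1 : ε ^ 2 * exp (-((p : ℝ) * Real.log K)) / K ^ 5 = ε ^ 2 / K ^ (p + 5) := by
    rw [exp_neg_natMul_log hK0 p, pow_add]; ring
  rw [e1] at h
  exact h

/-- **The cell's seed-scale question in this language**: `PseudoOrbitTransitionSeed q`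
(NegativeKickSharp.lean; decided: `↔ 5 ≤ q`, SeedScaleSharpClosure.lean) says exactly that every
member fires under the budget `ε²e^{-M}/K^q` at the tolerance `1/4 = (K²⁰/4)/K²⁰ = (K¹⁰/4)/K¹⁰`.
[cite: Tao2016AveragedNS, §5.5 Theorem 5.3] -/
theorem pseudoOrbitTransitionSeed_iff_firesUnderBudget {q : ℕ} :
    PseudoOrbitTransitionSeed q ↔
      ∀ K M ε : ℝ, 2 * 20 ^ 42 * (Nat.factorial 42 : ℝ) + 16 ≤ K → 3000 * Real.log K ≤ M →
        M ≤ K ^ 10 → 0 < ε → ε ≤ exp (-(10 * M)) / K ^ 100 →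
        FiresUnderBudget K M ε (K ^ 20 / 4) (K ^ 10 / 4) (ε ^ 2 * exp (-M) / K ^ q) := by
  have key : ∀ K : ℝ, 2 * 20 ^ 42 * (Nat.factorial 42 : ℝ) + 16 ≤ K →
      K ^ 20 / 4 / K ^ 20 = 1 / 4 ∧ K ^ 10 / 4 / K ^ 10 = 1 / 4 := by
    intro K hK
    have hB : (0 : ℝ) ≤ 2 * 20 ^ 42 * (Nat.factorial 42 : ℝ) := by positivity
    have hK0 : (0 : ℝ) < K := by linarith
    constructor
    · rw [div_div, mul_comm, ← div_div, div_self (pow_pos hK0 20).ne']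
    · rw [div_div, mul_comm, ← div_div, div_self (pow_pos hK0 10).ne']
  constructor
  · intro h K M ε hK hML hMK hε hεle δ δ₀ T Y hT hY h0 hb t ht
    have hδ₀ : 0 ≤ δ₀ := (norm_nonneg _).trans h0
    have hδ : 0 ≤ δ := by
      obtain ⟨V, -, hV⟩ := hY.defect 0 ⟨le_rfl, by linarith⟩
      exact (norm_nonneg _).trans hV
    obtain ⟨e20, e10⟩ := key K hK
    rw [e20, e10]
    exact h K M ε δ δ₀ T Y hK hML hMK hε hεle hT hδ₀ hδ hY h0 hb t ht
  · intro h K M ε δ δ₀ T Y hK hML hMK hε hεle hT _ _ hY h0 hb t ht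
    obtain ⟨e20, e10⟩ := key K hK
    have := h K M ε hK hML hMK hε hεle δ δ₀ T Y hT hY h0 hb t ht
    rw [e20, e10] at this
    exact this

end Literature.Analysis.FluidPDE.Tao2016AveragedNS
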